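import Summits.KontsevichZagierPeriods.Zeta5Search.WedgeDictionaryLevelDescentProof
import HarnessLib

/-!
# Level descent on the UNCLEAN cone, part 1: the boundary weights (§A of gen-1 g8's `levelDescentVFull` reduction)

HONEST FRAMING: systematic search; no irrationality claim unless certified.

OUR work (Summit side; planner gen-1 g8, 2026-08-20; memo `pub-zeta5-gen-1/D2-VFULL-PROOF-g8.md`; filed verbatim by the lead lane, split in two at
the section boundary §A | §B because of the 400-line rule — the mathematics and every declaration are unchanged).  This part: the regularised boundary
weights of `levelDescentVFull` (`WedgeDictionaryLevelDescent`, internally minted) in the index `m = b₇ − i < 0` ARE g7's symmetric weights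
`ldWeightSym b m` (`ldWeightBar_eq_ldWeight`); the truncated boundary weight `ldEW`, the kernel factor `ldKer` (a function of `N`, `b₃..b₆`, `μ` only),
`ldE`, the boundary sum `ldSE b := Σ_{m=−N}^{−1} ldE b m`; (T2) `ldEW_cross` / `ldSE_crossRel` — the boundary terms are CROSS-CONTIGUOUS termwise in
`m` by the same one-line identity as g7's `ldW_cross`; `ldSE_swap` (`{1,2,7}`-symmetry), `ldSE_eq_zero_of_clean` (no boundary terms on the clean cone),
`ldBoundary_sum_eq_ldSE` (re-indexing `i ↦ m`).  Part 2 (`WedgeDictionaryLevelDescentVFull`): (T1) the sourced two-term relation, the corrected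
wedge `casUVE`, the induction, and `levelDescentVFull_reduction_holds : ldSE_rowSource_stmt → levelDescentVFull`.
What this is NOT: a proof of `levelDescentVFull`; anything about irrationality.
-/

open Finset Polynomial

namespace Summit.KontsevichZagierPeriods.Zeta5Search.WedgeDictionary

open Summit.KontsevichZagierPeriods.Zeta5Search.DualSeries
open Literature.NumberTheory.Transcendental

/-! # §A  The boundary weights: the symmetric weight at negative `m` -/


/-! ## Definitions: the boundary weight as the symmetric weight at negative `m` -/

/-- The true support of the boundary weight: all `c_tj ≥ 0` (`t ∈ {1,2,7}`, `j ∈ B`) and `σ − N ≤ m ≤ −1`. -/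
def ldESupp (b : ℕ → ℤ) (m : ℤ) : Prop :=
  (∀ t ∈ ({1, 2, 7} : Finset ℕ), ∀ j ∈ Icc 3 6, 0 ≤ b 0 - b t - b j) ∧ m + 1 ≤ 0 ∧ sigmaT b - b 0 ≤ m

/-- `ldESupp` is decidable (finite conjunction of integer inequalities). -/
instance (b : ℕ → ℤ) (m : ℤ) : Decidable (ldESupp b m) := by unfold ldESupp; infer_instance

/-- The truncated boundary weight `Ω̄(b;m)`, `m < 0` (zero off the true support). -/
def ldEW (b : ℕ → ℤ) (m : ℤ) : ℚ := if ldESupp b m then ldWeightSym b m else 0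

/-- The kernel factor of the boundary term with `μ = −m ≥ 1`:
`(μ−1)! · Σ_{x=1}^{μ} (−1)^{x−1} R₅(x; b₃..b₆) / ((μ−x)! (x−1)! (x+N+1)_μ)` — a function of `N`, `b₃..b₆`, `μ` only. -/
def ldKer (b : ℕ → ℤ) (μ : ℕ) : ℚ :=
  (Nat.factorial (μ - 1) : ℚ) *
    ∑ x ∈ Icc 1 μ, (-1 : ℚ) ^ (x - 1) * kernel5 b x /
      ((Nat.factorial (μ - x) : ℚ) * (Nat.factorial (x - 1) : ℚ) * pochQ ((x : ℚ) + b 0 + 1) μ)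

/-- The boundary term `E(b;m) = Ω̄(b;m) · ldKer b (−m)` (`m < 0`; zero off the support). -/
def ldE (b : ℕ → ℤ) (m : ℤ) : ℚ := ldEW b m * ldKer b (-m).toNat

/-- The boundary sum `SE(b) = Σ_{m=−N}^{−1} E(b;m)`. -/
noncomputable def ldSE (b : ℕ → ℤ) : ℚ := ∑ m ∈ Icc (-(b 0)) (-1), ldE b m

/-- Off the support the boundary weight vanishes (definitional). -/
theorem ldEW_of_not_supp (b : ℕ → ℤ) (m : ℤ) (h : ¬ ldESupp b m) : ldEW b m = 0 := by simp [ldEW, h]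

/-- On the support the boundary weight is the symmetric weight (definitional). -/
theorem ldEW_of_supp (b : ℕ → ℤ) (m : ℤ) (h : ldESupp b m) : ldEW b m = ldWeightSym b m := by simp [ldEW, h]

/-! ## The kernel factor only sees `N` and `B` -/

/-- `kernel5` is unchanged by lowering slot 2. -/
theorem kernel5_low2 (b : ℕ → ℤ) (x : ℕ) : kernel5 (Function.update b 2 (b 2 - 1)) x = kernel5 b x := by
  unfold kernel5
  rw [low2_0]
  congr 1

/-- `kernel5` is unchanged by lowering slot 7. -/
theorem kernel5_low7 (b : ℕ → ℤ) (x : ℕ) : kernel5 (Function.update b 7 (b 7 - 1)) x = kernel5 b x := by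
  unfold kernel5
  rw [low7_0]
  congr 1

/-- `ldKer` is unchanged by lowering slot 2. -/
theorem ldKer_low2 (b : ℕ → ℤ) (μ : ℕ) : ldKer (Function.update b 2 (b 2 - 1)) μ = ldKer b μ := by
  simp only [ldKer, kernel5_low2, low2_0]

/-- `ldKer` is unchanged by lowering slot 7. -/
theorem ldKer_low7 (b : ℕ → ℤ) (μ : ℕ) : ldKer (Function.update b 7 (b 7 - 1)) μ = ldKer b μ := by
  simp only [ldKer, kernel5_low7, low7_0]

/-! ## (T2) The cross-contiguity of the boundary weights, termwise in `m` -/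

set_option maxHeartbeats 800000 in
/-- (T2), `m` in the support of `ldEW b`: then both lowered terms are present (interior case; the one-line identity). -/
theorem ldEW_cross_of_supp (b : ℕ → ℤ) (m : ℤ) (_hN : 0 ≤ b 0)
    (hbox : ∀ j ∈ Icc 1 7, 0 ≤ b j ∧ b j ≤ b 0) (hB : ∀ j ∈ Icc 3 6, 2 * b j ≤ b 0) (hd : 0 ≤ dOf b)
    (hb2 : 1 ≤ b 2) (hb7 : 1 ≤ b 7) (h1 : ldESupp b m) :
    ((b 2 : ℚ) - b 7) * ((dOf b : ℚ) + 1) * ldEW b m =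
      (b 2 : ℚ) * (∏ j ∈ ({1, 3, 4, 5, 6} : Finset ℕ), ((b 0 : ℚ) - b 2 - b j + 1)) * ldEW (Function.update b 2 (b 2 - 1)) m -
        (b 7 : ℚ) * (∏ j ∈ ({1, 3, 4, 5, 6} : Finset ℕ), ((b 0 : ℚ) - b 7 - b j + 1)) * ldEW (Function.update b 7 (b 7 - 1)) m := by
  simp only [mem_Icc] at hbox hB
  have hx1 := hbox 1 (by norm_num); have hx2 := hbox 2 (by norm_num); have hx3 := hbox 3 (by norm_num)
  have hx4 := hbox 4 (by norm_num); have hx5 := hbox 5 (by norm_num); have hx6 := hbox 6 (by norm_num)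
  have hx7 := hbox 7 (by norm_num)
  have hB3 := hB 3 (by norm_num); have hB4 := hB 4 (by norm_num); have hB5 := hB 5 (by norm_num)
  have hB6 := hB 6 (by norm_num)
  have h1' := h1
  simp only [ldESupp, Icc_three_six, mem_insert, mem_singleton, forall_eq_or_imp, forall_eq, sigmaT] at h1'
  have h2 : ldESupp (Function.update b 2 (b 2 - 1)) m := by
    simp only [ldESupp, Icc_three_six, mem_insert, mem_singleton, forall_eq_or_imp, forall_eq, sigmaT,
      low2_0, low2_1, low2_2, low2_3, low2_4, low2_5, low2_6, low2_7]
    omega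
  have h3 : ldESupp (Function.update b 7 (b 7 - 1)) m := by
    simp only [ldESupp, Icc_three_six, mem_insert, mem_singleton, forall_eq_or_imp, forall_eq, sigmaT,
      low7_0, low7_1, low7_2, low7_3, low7_4, low7_5, low7_6, low7_7]
    omega
  simp only [ldEW, h1, h2, h3, if_true, prod_insert, mem_insert, mem_singleton, prod_singleton, Nat.reduceEqDiff, or_self,
    not_false_eq_true]
  have s2 := ldStep2 b m hb2 (by omega) (by omega) (by omega) (by omega) (by omega) hd (by omega)
  have s7 := ldStep7 b m hb7 (by omega) (by omega) (by omega) (by omega) (by omega) hd (by omega)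
  have hne : ((b 0 : ℚ) + m - (b 1 + b 2 + b 7) + 1) ≠ 0 := by
    have : (0 : ℤ) < b 0 + m - (b 1 + b 2 + b 7) + 1 := by omega
    have : (0 : ℚ) < ((b 0 + m - (b 1 + b 2 + b 7) + 1 : ℤ) : ℚ) := by exact_mod_cast this
    push_cast at this
    exact this.ne'
  apply mul_left_cancel₀ hne
  linear_combination (-((b 0 : ℚ) - b 2 - b 1 + 1)) * s2 + ((b 0 : ℚ) - b 7 - b 1 + 1) * s7

set_option maxHeartbeats 800000 in
/-- (T2), `m` outside the support of `ldEW b`: lower edge `m = σ − N − 1` (the two lowered terms cancel), a vanishing factor of `Π₂` or `Π₇`, or nothing. -/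
theorem ldEW_cross_of_not_supp (b : ℕ → ℤ) (m : ℤ) (_hN : 0 ≤ b 0)
    (hbox : ∀ j ∈ Icc 1 7, 0 ≤ b j ∧ b j ≤ b 0) (hB : ∀ j ∈ Icc 3 6, 2 * b j ≤ b 0) (hd : 0 ≤ dOf b)
    (hb2 : 1 ≤ b 2) (hb7 : 1 ≤ b 7) (h1 : ¬ ldESupp b m) :
    ((b 2 : ℚ) - b 7) * ((dOf b : ℚ) + 1) * ldEW b m =
      (b 2 : ℚ) * (∏ j ∈ ({1, 3, 4, 5, 6} : Finset ℕ), ((b 0 : ℚ) - b 2 - b j + 1)) * ldEW (Function.update b 2 (b 2 - 1)) m -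
        (b 7 : ℚ) * (∏ j ∈ ({1, 3, 4, 5, 6} : Finset ℕ), ((b 0 : ℚ) - b 7 - b j + 1)) * ldEW (Function.update b 7 (b 7 - 1)) m := by
  simp only [mem_Icc] at hbox hB
  have hx1 := hbox 1 (by norm_num); have hx2 := hbox 2 (by norm_num); have hx3 := hbox 3 (by norm_num)
  have hx4 := hbox 4 (by norm_num); have hx5 := hbox 5 (by norm_num); have hx6 := hbox 6 (by norm_num)
  have hx7 := hbox 7 (by norm_num)
  have hB3 := hB 3 (by norm_num); have hB4 := hB 4 (by norm_num); have hB5 := hB 5 (by norm_num)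
  have hB6 := hB 6 (by norm_num)
  have hdq : (0 : ℚ) ≤ (dOf b : ℚ) := by exact_mod_cast hd
  simp only [ldEW, prod_insert, mem_insert, mem_singleton, prod_singleton, Nat.reduceEqDiff, or_self,
    not_false_eq_true]
  by_cases h2 : ldESupp (Function.update b 2 (b 2 - 1)) m <;>
    by_cases h3 : ldESupp (Function.update b 7 (b 7 - 1)) m <;>
    simp only [h1, h2, h3, if_true, if_false] <;>
    simp only [ldESupp, Icc_three_six, mem_insert, mem_singleton, forall_eq_or_imp, forall_eq, sigmaT,
      low2_0, low2_1, low2_2, low2_3, low2_4, low2_5, low2_6, low2_7, low7_0, low7_1, low7_2, low7_3, low7_4, low7_5, low7_6, low7_7] at h1 h2 h3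
  · -- lower edge m = σ − N − 1: only the two lowered terms
    have t7 := ldStep7_at_low2 b m hb7 (by omega) (by omega) (by omega) (by omega) (by omega) hd (by omega)
    have t2 := ldStep2_at_low7 b m hb2 (by omega) (by omega) (by omega) (by omega) (by omega) hd (by omega)
    obtain rfl : m = b 1 + b 2 + b 7 - b 0 - 1 := by omega
    push_cast at t7 t2 ⊢
    have hne : ((dOf b : ℚ) + 2) ≠ 0 := ne_of_gt (by linarith)
    apply mul_left_cancel₀ hne
    linear_combination ((b 2 : ℚ) * (((b 0 : ℚ) - b 2 - b 3 + 1) * ((b 0 : ℚ) - b 2 - b 4 + 1) * ((b 0 : ℚ) - b 2 - b 5 + 1) * ((b 0 : ℚ) - b 2 - b 6 + 1))) * t7 - ((b 7 : ℚ) * (((b 0 : ℚ) - b 7 - b 3 + 1) * ((b 0 : ℚ) - b 7 - b 4 + 1) * ((b 0 : ℚ) - b 7 - b 5 + 1) * ((b 0 : ℚ) - b 7 - b 6 + 1))) * t2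
  · -- a factor of Π₂ vanishes
    have hz : b 0 - b 2 - b 1 + 1 = 0 ∨ b 0 - b 2 - b 3 + 1 = 0 ∨ b 0 - b 2 - b 4 + 1 = 0 ∨
        b 0 - b 2 - b 5 + 1 = 0 ∨ b 0 - b 2 - b 6 + 1 = 0 := by omega
    have hP : (b 0 - b 2 - b 1 + 1) * ((b 0 - b 2 - b 3 + 1) * ((b 0 - b 2 - b 4 + 1) *
        ((b 0 - b 2 - b 5 + 1) * (b 0 - b 2 - b 6 + 1)))) = 0 := by
      rcases hz with hz | hz | hz | hz | hz <;> simp [hz]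
    have hPq : ((b 0 : ℚ) - b 2 - b 1 + 1) * (((b 0 : ℚ) - b 2 - b 3 + 1) * (((b 0 : ℚ) - b 2 - b 4 + 1) *
        (((b 0 : ℚ) - b 2 - b 5 + 1) * ((b 0 : ℚ) - b 2 - b 6 + 1)))) = 0 := by
      exact_mod_cast hP
    linear_combination (-((b 2 : ℚ) * ldWeightSym (Function.update b 2 (b 2 - 1)) m)) * hPq
  · -- a factor of Π₇ vanishes
    have hz : b 0 - b 7 - b 1 + 1 = 0 ∨ b 0 - b 7 - b 3 + 1 = 0 ∨ b 0 - b 7 - b 4 + 1 = 0 ∨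
        b 0 - b 7 - b 5 + 1 = 0 ∨ b 0 - b 7 - b 6 + 1 = 0 := by omega
    have hP : (b 0 - b 7 - b 1 + 1) * ((b 0 - b 7 - b 3 + 1) * ((b 0 - b 7 - b 4 + 1) *
        ((b 0 - b 7 - b 5 + 1) * (b 0 - b 7 - b 6 + 1)))) = 0 := by
      rcases hz with hz | hz | hz | hz | hz <;> simp [hz]
    have hPq : ((b 0 : ℚ) - b 7 - b 1 + 1) * (((b 0 : ℚ) - b 7 - b 3 + 1) * (((b 0 : ℚ) - b 7 - b 4 + 1) *
        (((b 0 : ℚ) - b 7 - b 5 + 1) * ((b 0 : ℚ) - b 7 - b 6 + 1)))) = 0 := by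
      exact_mod_cast hP
    linear_combination ((b 7 : ℚ) * ldWeightSym (Function.update b 7 (b 7 - 1)) m) * hPq
  · ring

/-- STATEMENT (T2, PROVED below as `ldEW_cross`): the truncated boundary weights satisfy the cross-contiguity relation of the wedges TERMWISE in `m`,
on the extended region (`B` in the half box, triple slots in `[0, N]`, `d ≥ 0`, `b₂, b₇ ≥ 1`) — the same identity as `ldW_cross_stmt`. -/
def ldEW_cross_stmt : Prop :=
  ∀ (b : ℕ → ℤ) (m : ℤ), 0 ≤ b 0 → (∀ j ∈ Icc 1 7, 0 ≤ b j ∧ b j ≤ b 0) → (∀ j ∈ Icc 3 6, 2 * b j ≤ b 0) → 0 ≤ dOf b →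
    1 ≤ b 2 → 1 ≤ b 7 →
    ((b 2 : ℚ) - b 7) * ((dOf b : ℚ) + 1) * ldEW b m =
      (b 2 : ℚ) * (∏ j ∈ ({1, 3, 4, 5, 6} : Finset ℕ), ((b 0 : ℚ) - b 2 - b j + 1)) * ldEW (Function.update b 2 (b 2 - 1)) m -
        (b 7 : ℚ) * (∏ j ∈ ({1, 3, 4, 5, 6} : Finset ℕ), ((b 0 : ℚ) - b 7 - b j + 1)) * ldEW (Function.update b 7 (b 7 - 1)) m

/-- **(T2) PROVED.** -/
theorem ldEW_cross : ldEW_cross_stmt := by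
  intro b m hN hbox hB hd hb2 hb7
  by_cases h1 : ldESupp b m
  · exact ldEW_cross_of_supp b m hN hbox hB hd hb2 hb7 h1
  · exact ldEW_cross_of_not_supp b m hN hbox hB hd hb2 hb7 h1

/-- (T2) for the boundary terms `E(b;m)` (the kernel factor is common to the three shapes). -/
theorem ldE_cross (b : ℕ → ℤ) (m : ℤ) (hN : 0 ≤ b 0) (hbox : ∀ j ∈ Icc 1 7, 0 ≤ b j ∧ b j ≤ b 0)
    (hB : ∀ j ∈ Icc 3 6, 2 * b j ≤ b 0) (hd : 0 ≤ dOf b) (hb2 : 1 ≤ b 2) (hb7 : 1 ≤ b 7) :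
    ((b 2 : ℚ) - b 7) * ((dOf b : ℚ) + 1) * ldE b m =
      (b 2 : ℚ) * mixedPi2 b * ldE (lowerSlot b 2) m - (b 7 : ℚ) * mixedPi7 b * ldE (lowerSlot b 7) m := by
  have h := ldEW_cross b m hN hbox hB hd hb2 hb7
  simp only [ldE, lowerSlot, mixedPi2, mixedPi7, ldKer_low2, ldKer_low7]
  linear_combination (ldKer b (-m).toNat) * h

/-- **(T2) summed: the boundary sum is cross-contiguous** (extended region, `b₂, b₇ ≥ 1`). -/
theorem ldSE_crossRel (b : ℕ → ℤ) (hN : 0 ≤ b 0) (hbox : ∀ j ∈ Icc 1 7, 0 ≤ b j ∧ b j ≤ b 0)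
    (hB : ∀ j ∈ Icc 3 6, 2 * b j ≤ b 0) (hd : 0 ≤ dOf b) (hb2 : 1 ≤ b 2) (hb7 : 1 ≤ b 7) : CrossRel ldSE b := by
  unfold CrossRel ldSE
  have e2 : lowerSlot b 2 0 = b 0 := lowerSlot2_zero b
  have e7 : lowerSlot b 7 0 = b 0 := by simp [lowerSlot]
  rw [e2, e7, mul_sum, mul_sum, mul_sum, ← sum_sub_distrib]
  exact sum_congr rfl fun m _ => by
    have h := ldE_cross b m hN hbox hB hd hb2 hb7
    linear_combination h

/-! ## No boundary terms on the clean cone; symmetry -/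

/-- On the clean cone `σ ≥ N` every boundary term vanishes. -/
theorem ldE_eq_zero_of_clean (b : ℕ → ℤ) (m : ℤ) (h : b 0 ≤ sigmaT b) (hm : m + 1 ≤ 0) : ldE b m = 0 := by
  have : ¬ ldESupp b m := fun hS => by have := hS.2.2; omega
  simp [ldE, ldEW, this]

/-- On the clean cone `σ ≥ N` the boundary sum vanishes. -/
theorem ldSE_eq_zero_of_clean (b : ℕ → ℤ) (h : b 0 ≤ sigmaT b) : ldSE b = 0 := by
  unfold ldSE
  exact sum_eq_zero fun m hm => ldE_eq_zero_of_clean b m h (by have := (mem_Icc.1 hm).2; omega)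

section symmetry
variable (b : ℕ → ℤ) {j k : ℕ} (hj : j ∈ ({1, 2, 7} : Finset ℕ)) (hk : k ∈ ({1, 2, 7} : Finset ℕ))
include hj hk

/-- The support of the boundary weight is `{1,2,7}`-symmetric. -/
theorem ldESupp_swap (m : ℤ) : ldESupp (fun i => b (Equiv.swap j k i)) m ↔ ldESupp b m := by
  have h0 := swap_b0 b hj hk
  have hT : ∀ t ∈ ({1, 2, 7} : Finset ℕ), Equiv.swap j k t ∈ ({1, 2, 7} : Finset ℕ) := by
    intro t ht
    simp only [mem_insert, mem_singleton] at hj hk ht ⊢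
    rcases hj with rfl | rfl | rfl <;> rcases hk with rfl | rfl | rfl <;> rcases ht with rfl | rfl | rfl <;>
      simp [Equiv.swap_apply_def]
  have part1 : (∀ t ∈ ({1, 2, 7} : Finset ℕ), ∀ x ∈ Icc 3 6,
        0 ≤ b (Equiv.swap j k 0) - b (Equiv.swap j k t) - b (Equiv.swap j k x)) ↔
      ∀ t ∈ ({1, 2, 7} : Finset ℕ), ∀ x ∈ Icc 3 6, 0 ≤ b 0 - b t - b x := by
    constructor
    · intro H t ht x hx
      have := H (Equiv.swap j k t) (hT t ht) x hx
      rwa [h0, Equiv.swap_apply_self, swap_bB b hj hk hx] at this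
    · intro H t ht x hx
      rw [h0, swap_bB b hj hk hx]
      exact H _ (hT t ht) x hx
  simp only [ldESupp]
  rw [part1, sigmaT_swap b hj hk, h0]

/-- The truncated boundary weight is `{1,2,7}`-symmetric. -/
theorem ldEW_swap (m : ℤ) : ldEW (fun i => b (Equiv.swap j k i)) m = ldEW b m := by
  simp only [ldEW]
  rw [ldWeightSym_swap b hj hk]
  by_cases h : ldESupp b m
  · rw [if_pos h, if_pos ((ldESupp_swap b hj hk m).2 h)]
  · rw [if_neg h, if_neg (fun h' => h ((ldESupp_swap b hj hk m).1 h'))]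

/-- The level-5 kernel is `{1,2,7}`-symmetric (it only sees `N` and `B`). -/
theorem kernel5_swap (x : ℕ) : kernel5 (fun i => b (Equiv.swap j k i)) x = kernel5 b x := by
  unfold kernel5
  simp only [swap_b0 b hj hk]
  congr 1
  exact prod_congr rfl fun i hi => by simp only [swap_bB b hj hk hi]

/-- The kernel factor is `{1,2,7}`-symmetric. -/
theorem ldKer_swap (μ : ℕ) : ldKer (fun i => b (Equiv.swap j k i)) μ = ldKer b μ := by
  unfold ldKer
  simp only [kernel5_swap b hj hk, swap_b0 b hj hk]

/-- **The boundary sum is `{1,2,7}`-symmetric.** -/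
theorem ldSE_swap : ldSE (fun i => b (Equiv.swap j k i)) = ldSE b := by
  unfold ldSE
  simp only [swap_b0 b hj hk]
  exact sum_congr rfl fun m _ => by simp only [ldE, ldEW_swap b hj hk, ldKer_swap b hj hk]

end symmetry

/-! ## Re-indexing: the `i`-indexed boundary sum of `levelDescentVFull` is `ldSE` -/

/-- For `i > b₇` the deleted factor is `facQ` of a negative integer, i.e. `1`: `Ω̄_i(b) = Ω_i(b)` as rational numbers. -/
theorem ldWeightBar_eq_ldWeight (b : ℕ → ℤ) (i : ℤ) (h : b 7 < i) : ldWeightBar b i = ldWeight b i := by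
  have h1 : facQ (b 7 - i) = 1 := by
    have : (b 7 - i).toNat = 0 := Int.toNat_eq_zero.mpr (by omega)
    simp [facQ, this]
  simp only [ldWeightBar, ldWeight, h1, mul_one]

/-- The boundary term in the index `i = b₇ + μ` is `E(b; −μ)`'s untruncated form: `ldBoundary b i = ldWeightSym b (b₇ − i) · ldKer b (i − b₇)`. -/
theorem ldBoundary_eq (b : ℕ → ℤ) (i : ℤ) (h : b 7 < i) :
    ldBoundary b i = ldWeightSym b (b 7 - i) * ldKer b (i - b 7).toNat := by
  have e : ldBoundary b i = ldWeightBar b i * ldKer b (i - b 7).toNat := by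
    simp only [ldBoundary, ldKer, mul_assoc]
  rw [e, ldWeightBar_eq_ldWeight b i h, ldWeight_eq_sym]

/-- **Re-indexing PROVED.** On the half box (`0 ≤ b_k`, `2b_k ≤ N`, all slots), the boundary sum of `levelDescentVFull` equals `ldSE b`. -/
theorem ldBoundary_sum_eq_ldSE (b : ℕ → ℤ) (_hN : 0 ≤ b 0) (hB : ∀ k ∈ Icc 1 7, 0 ≤ b k ∧ 2 * b k ≤ b 0) :
    ∑ i ∈ Icc (b 7 + 1) (b 0 - b 1 - b 2), ldBoundary b i = ldSE b := by
  simp only [mem_Icc] at hB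
  have h1 := hB 1 (by norm_num); have h2 := hB 2 (by norm_num); have h3 := hB 3 (by norm_num)
  have h4 := hB 4 (by norm_num); have h5 := hB 5 (by norm_num); have h6 := hB 6 (by norm_num)
  have h7 := hB 7 (by norm_num)
  -- reflect the index: i = b₇ − m
  have hA : ∑ i ∈ Icc (b 7 + 1) (b 0 - b 1 - b 2), ldBoundary b i =
      ∑ m ∈ Icc (b 7 - (b 0 - b 1 - b 2)) (-1), ldWeightSym b m * ldKer b (-m).toNat := by
    apply Finset.sum_nbij' (fun i => b 7 - i) (fun m => b 7 - m)
    · intro i hi; simp only [mem_Icc] at hi ⊢; omega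
    · intro m hm; simp only [mem_Icc] at hm ⊢; omega
    · intro i _; ring
    · intro m _; ring
    · intro i hi
      simp only [mem_Icc] at hi
      rw [ldBoundary_eq b i (by omega)]
      congr 2
      omega
  rw [hA]
  unfold ldSE
  symm
  rw [← Finset.sum_subset (s₁ := Icc (b 7 - (b 0 - b 1 - b 2)) (-1)) (s₂ := Icc (-(b 0)) (-1))]
  · apply Finset.sum_congr rfl
    intro m hm
    simp only [mem_Icc] at hm
    unfold ldE
    rw [ldEW_of_supp]
    refine ⟨?_, by omega, ?_⟩
    · intro t ht j hj
      simp only [Icc_three_six, mem_insert, mem_singleton] at ht hj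
      rcases ht with rfl | rfl | rfl <;> rcases hj with rfl | rfl | rfl | rfl <;> omega
    · simp only [sigmaT]; omega
  · intro m hm
    simp only [mem_Icc] at hm ⊢
    omega
  · intro m _ hnot
    unfold ldE
    rw [ldEW_of_not_supp, zero_mul]
    intro hS
    apply hnot
    obtain ⟨-, hm1, hσ⟩ := hS
    simp only [sigmaT] at hσ
    simp only [mem_Icc]
    omega

end Summit.KontsevichZagierPeriods.Zeta5Search.WedgeDictionary
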